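import Mathlib.Analysis.SpecialFunctions.Pow.Real
import HarnessLib

/-!
# Hamilton's Lemma 2.2 and the bookkeeping of Thm. 2.1, as real inequalities
(topic `Geometry/Riemannian`)

Part of the decomposition of `Literature.Geometry.Riemannian.hamilton_chenZhu_pinching`
(`PinchingEstimates.lean`), towards the ODE part of Hamilton 1997, Thm. 2.1 (pp. 13–16).
Hamilton (p. 15) reduces the preservation of `2b₃ ≤ (1 + K/ln x) x`, `x = √((a₁+a₂)(c₁+c₂))`,
to `(λ - 1)²(D + E₁) ≤ Kλ(E₁ + E₂)` with `λ = 2b₃/x`, `D = a₃ + c₃ + 2b₁`,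
`E₁ = [(a₁-b₁)² + (a₂-b₂)² + 2a₂(b₂-b₁)]/(2(a₁+a₂)) + [same with c]`, `E₂ = 2b₁(b₃-b₂)/b₃`, and
proves **Lemma 2.2**: `E₁ + E₂ ≥ δ(λ-1)²|Rm|` for a `δ > 0` depending only on the pinching
constants. PROVED here as inequalities between real numbers — the spectral quantities enter
only through the relations established in `PinchingEstimatesImprovingSpectral.lean`
(`a₁ ≤ a₂ ≤ a₃`, `b₁ = β ≤ b₂ ≤ b₃ = Y` via `Y² + 2β² ≤ tr(BᵗB) ≤ 2Y² + β²`,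
`|det B| ≤ β(tr - β²)/2`, the Cor. 1.5 bounds `a₃, b₃, c₃ ≤ Ξ(a₁+a₂), Ξ(c₁+c₂)`):

* `lemma22_lower` — with `ℓ = ½[(a₁²+a₂²+S_A)/(a₁+a₂) + (c₁²+c₂²+S_C)/(c₁+c₂)] + a₃ + c₃`
  (the lower bound for `d/dt ln x`) and `μ = uᵀAu + vᵀCv + 2 det B/Y²` (the value of
  `d/dt ln b₃`): `μ ≤ ℓ` and `(2Y - x)² ≤ 512 Ξ₁² · x (ℓ - μ)`, `Ξ₁ = max{Ξ, 1}` — Hamilton's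
  Lemma 2.2 with explicit `δ` (his two cases: `b₁` small against `|Rm|`, or all of
  `a₁, a₂, b₁, b₂, c₁, c₂` comparable);
* `ell_le` — `ℓ ≤ 14 Ξ₁³ x` (Hamilton's "`D ≤ C|Rm|`");
* `improving_bookkeeping` — the boundary computation of p. 15 in barrier form: if
  `(2Y - x)² ≤ C_δ x(ℓ - μ)`, `ℓ ≤ C_ℓ x`, `K ≥ C_ℓ C_δ` (here `= 7168 Ξ₁⁵`), `L ≥ 2` and
  `G = (1 + K/L)x - 2Y ≤ 0`, then `M · G ≤ (1 + K/L - K/L²) x ℓ - 2Y μ` whenever `μ ≤ M`.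

## References

* R. S. Hamilton, *Four-manifolds with positive isotropic curvature*, Comm. Anal. Geom. 5 (1997)
  1–92, §2.2, Thm. 2.1 and Lemma 2.2 (pp. 13–16). [Hamilton1997]
-/

noncomputable section

open Real

namespace Literature.Geometry.Riemannian

namespace HamiltonODE

/-- Cauchy–Schwarz with six terms: `(Σ tᵢ)² ≤ 6 Σ tᵢ²`. [folklore] -/
theorem sq_sum6_le (t₁ t₂ t₃ t₄ t₅ t₆ : ℝ) :
    (t₁ + t₂ + t₃ + t₄ + t₅ + t₆) ^ 2 ≤ 6 * (t₁ ^ 2 + t₂ ^ 2 + t₃ ^ 2 + t₄ ^ 2 + t₅ ^ 2 + t₆ ^ 2) := by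
  nlinarith [sq_nonneg (t₁ - t₂), sq_nonneg (t₁ - t₃), sq_nonneg (t₁ - t₄), sq_nonneg (t₁ - t₅),
    sq_nonneg (t₁ - t₆), sq_nonneg (t₂ - t₃), sq_nonneg (t₂ - t₄), sq_nonneg (t₂ - t₅),
    sq_nonneg (t₂ - t₆), sq_nonneg (t₃ - t₄), sq_nonneg (t₃ - t₅), sq_nonneg (t₃ - t₆),
    sq_nonneg (t₄ - t₅), sq_nonneg (t₄ - t₆), sq_nonneg (t₅ - t₆)]

/-- Hamilton's rearrangement `a₁² + a₂² + b₁² + b₂² = 2b₁(a₁+a₂) + (a₁-b₁)² + (a₂-b₂)² + 2a₂(b₂-b₁)`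
turned into the lower bound `2b₁ + [(a₁-b₁)² + (a₂-b₂)²]/(a₁+a₂) + (b₂-b₁) ≤ (a₁²+a₂²+S)/(a₁+a₂)`
for `S ≥ b₁² + b₂²`, `a₁ ≤ a₂`, `b₁ ≤ b₂` (so `2a₂ ≥ a₁ + a₂ > 0`).
[cite: Hamilton1997, §2.2, Thm. 2.1 (proof, p. 15)] -/
theorem quot_lower {a₁ a₂ S β s : ℝ} (hα : 0 < a₁ + a₂) (ha : a₁ ≤ a₂) (hβs : β ≤ s)
    (hS : β ^ 2 + s ^ 2 ≤ S) :
    2 * β + ((a₁ - β) ^ 2 + (a₂ - s) ^ 2) / (a₁ + a₂) + (s - β) ≤ (a₁ ^ 2 + a₂ ^ 2 + S) / (a₁ + a₂) := by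
  have e : 2 * β + ((a₁ - β) ^ 2 + (a₂ - s) ^ 2) / (a₁ + a₂) + (s - β) =
      ((2 * β + (s - β)) * (a₁ + a₂) + ((a₁ - β) ^ 2 + (a₂ - s) ^ 2)) / (a₁ + a₂) := by
    field_simp
    ring
  rw [e]
  refine div_le_div_of_nonneg_right ?_ hα.le
  nlinarith [mul_nonneg (sub_nonneg.2 hβs) (by linarith : (0 : ℝ) ≤ 2 * a₂ - (a₁ + a₂))]

/-- The determinant term: `2 det B / Y² ≤ b₁ + b₁ b₂²/Y²` from `|det B| ≤ b₁(b₂² + b₃²)/2`. [folklore] -/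
theorem det_term_le {d β F Y s : ℝ} (hY : 0 < Y) (hd : |d| ≤ β * (F - β ^ 2) / 2)
    (hF : F - β ^ 2 = Y ^ 2 + s ^ 2) : 2 * d / Y ^ 2 ≤ β + β * s ^ 2 / Y ^ 2 := by
  have hY2 : 0 < Y ^ 2 := by positivity
  have h1 : 2 * d ≤ β * (Y ^ 2 + s ^ 2) := by rw [← hF]; linarith [le_abs_self d]
  rw [div_le_iff₀ hY2, add_mul, div_mul_cancel₀ _ hY2.ne']
  linarith

/-- `b₁ (b₃ - b₂)/b₃ ≤ b₁ - b₁ b₂²/b₃²` for `0 ≤ b₂ ≤ b₃`, `b₁ ≥ 0` (half of Hamilton's `E₂`). [folklore] -/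
theorem tau_term_le {β Y s : ℝ} (hY : 0 < Y) (hβ : 0 ≤ β) (hs : 0 ≤ s) (hsY : s ≤ Y) :
    β * (Y - s) / Y ≤ β - β * s ^ 2 / Y ^ 2 := by
  have hY2 : 0 < Y ^ 2 := by positivity
  have e : β * (Y - s) / Y + β * s ^ 2 / Y ^ 2 = β * (Y * (Y - s) + s ^ 2) / Y ^ 2 := by
    field_simp
  have h : β * (Y * (Y - s) + s ^ 2) / Y ^ 2 ≤ β := by
    rw [div_le_iff₀ hY2]
    nlinarith [mul_nonneg (mul_nonneg hβ hs) (sub_nonneg.2 hsY)]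
  linarith

section Lemma22

variable {a₁ a₂ a₃ c₁ c₂ c₃ SA SC Y β F uA vC d Ξ x ℓ μ : ℝ}
  (ha₁₂ : a₁ ≤ a₂) (ha₂₃ : a₂ ≤ a₃) (hc₁₂ : c₁ ≤ c₂) (hc₂₃ : c₂ ≤ c₃) (hα : 0 < a₁ + a₂)
  (hγ : 0 < c₁ + c₂) (hx2 : x ^ 2 = (a₁ + a₂) * (c₁ + c₂)) (hx : 0 < x) (hY : 0 < Y) (hβ : 0 ≤ β)
  (hF1 : Y ^ 2 + 2 * β ^ 2 ≤ F) (hF2 : F ≤ 2 * Y ^ 2 + β ^ 2) (hSA : F - Y ^ 2 ≤ SA) (hSA' : SA ≤ F)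
  (hSC : F - Y ^ 2 ≤ SC) (hSC' : SC ≤ F) (huA : uA ≤ a₃) (hvC : vC ≤ c₃)
  (hd : |d| ≤ β * (F - β ^ 2) / 2) (hΞ : 0 < Ξ) (ha₃α : a₃ ≤ Ξ * (a₁ + a₂))
  (ha₃γ : a₃ ≤ Ξ * (c₁ + c₂)) (hc₃α : c₃ ≤ Ξ * (a₁ + a₂)) (hc₃γ : c₃ ≤ Ξ * (c₁ + c₂))
  (hYα : Y ≤ Ξ * (a₁ + a₂)) (hYγ : Y ≤ Ξ * (c₁ + c₂))
  (hℓ : ℓ = ((a₁ ^ 2 + a₂ ^ 2 + SA) / (a₁ + a₂) + (c₁ ^ 2 + c₂ ^ 2 + SC) / (c₁ + c₂)) / 2 + a₃ + c₃)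
  (hμ : μ = uA + vC + 2 * d / Y ^ 2)

include hα hγ hx2 hx ha₁₂ ha₂₃ hc₁₂ hc₂₃ hΞ ha₃γ hc₃α in
/-- The sizes `a₁ + a₂`, `c₁ + c₂` are `O(x)`: both `≤ 2Ξ₁ x`, `Ξ₁ = max{Ξ, 1}`. [folklore] -/
theorem sizes_le : a₁ + a₂ ≤ 2 * max Ξ 1 * x ∧ c₁ + c₂ ≤ 2 * max Ξ 1 * x := by
  have hΞ₁ : 1 ≤ max Ξ 1 := le_max_right _ _
  have hΞle : Ξ ≤ max Ξ 1 := le_max_left _ _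
  have hαγ : a₁ + a₂ ≤ 2 * Ξ * (c₁ + c₂) := by linarith only [ha₁₂, ha₂₃, ha₃γ]
  have hγα : c₁ + c₂ ≤ 2 * Ξ * (a₁ + a₂) := by linarith only [hc₁₂, hc₂₃, hc₃α]
  have hm : 2 * Ξ ≤ (2 * max Ξ 1) ^ 2 := by nlinarith only [hΞ₁, hΞle]
  have hα2x : (a₁ + a₂) ^ 2 ≤ (2 * max Ξ 1 * x) ^ 2 := by
    have h1 : (a₁ + a₂) ^ 2 ≤ 2 * Ξ * x ^ 2 := by
      rw [hx2]; nlinarith only [hαγ, hα]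
    calc (a₁ + a₂) ^ 2 ≤ 2 * Ξ * x ^ 2 := h1
      _ ≤ (2 * max Ξ 1) ^ 2 * x ^ 2 := mul_le_mul_of_nonneg_right hm (sq_nonneg x)
      _ = (2 * max Ξ 1 * x) ^ 2 := by ring
  have hγ2x : (c₁ + c₂) ^ 2 ≤ (2 * max Ξ 1 * x) ^ 2 := by
    have h1 : (c₁ + c₂) ^ 2 ≤ 2 * Ξ * x ^ 2 := by
      rw [hx2]; nlinarith only [hγα, hγ]
    calc (c₁ + c₂) ^ 2 ≤ 2 * Ξ * x ^ 2 := h1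
      _ ≤ (2 * max Ξ 1) ^ 2 * x ^ 2 := mul_le_mul_of_nonneg_right hm (sq_nonneg x)
      _ = (2 * max Ξ 1 * x) ^ 2 := by ring
  have h0 : 0 ≤ 2 * max Ξ 1 * x := by positivity
  exact ⟨le_of_sq_le_sq hα2x h0, le_of_sq_le_sq hγ2x h0⟩

include hx2 hx hY hΞ hYα hYγ hα in
/-- `Y ≤ Ξ₁ x`. [folklore] -/
theorem Y_le : Y ≤ max Ξ 1 * x := by
  have hΞle : Ξ ≤ max Ξ 1 := le_max_left _ _
  have h1 : Y ^ 2 ≤ (max Ξ 1 * x) ^ 2 := by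
    have : Y ^ 2 ≤ Ξ ^ 2 * x ^ 2 := by
      rw [hx2]; nlinarith only [mul_le_mul hYα hYγ hY.le (by positivity), hα, hΞ]
    calc Y ^ 2 ≤ Ξ ^ 2 * x ^ 2 := this
      _ ≤ max Ξ 1 ^ 2 * x ^ 2 :=
          mul_le_mul_of_nonneg_right (pow_le_pow_left₀ hΞ.le hΞle 2) (sq_nonneg x)
      _ = (max Ξ 1 * x) ^ 2 := by ring
  exact le_of_sq_le_sq h1 (by positivity)

include ha₁₂ ha₂₃ hc₁₂ hc₂₃ hα hγ hx2 hx hY hβ hF1 hF2 hSA hSC huA hvC hd hΞ ha₃γ hc₃α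
  hYα hYγ hℓ hμ in
/-- **Hamilton's Lemma 2.2 (with the two differential inequalities built in).** With `ℓ` the
lower bound for `d/dt ln √((a₁+a₂)(c₁+c₂))` and `μ` the value of `d/dt ln b₃` at the extremal
vectors (see the module docstring), `μ ≤ ℓ` and `(2Y - x)² ≤ 512 Ξ₁² x (ℓ - μ)`, i.e.
`E₁ + E₂ ≥ δ (λ - 1)² x` with `λ = 2Y/x`, `δ = 1/(512 Ξ₁²)`. [cite: Hamilton1997, §2.2, Lemma 2.2 (p. 16)] -/
theorem lemma22_lower (hlam : x ≤ 2 * Y) :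
    μ ≤ ℓ ∧ (2 * Y - x) ^ 2 ≤ 512 * max Ξ 1 ^ 2 * x * (ℓ - μ) := by
  have hΞ₁ : 1 ≤ max Ξ 1 := le_max_right _ _
  have hΞle : Ξ ≤ max Ξ 1 := le_max_left _ _
  obtain ⟨hαx, hγx⟩ := sizes_le ha₁₂ ha₂₃ hc₁₂ hc₂₃ hα hγ hx2 hx hΞ ha₃γ hc₃α
  have hYx : Y ≤ max Ξ 1 * x := Y_le hα hx2 hx hY hΞ hYα hYγ
  -- the middle singular value `s = b₂`: `β ≤ s ≤ Y`, `s² = F - Y² - β²`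
  have hσ0 : 0 ≤ F - Y ^ 2 - β ^ 2 := by nlinarith only [hF1, sq_nonneg β]
  set s := Real.sqrt (F - Y ^ 2 - β ^ 2) with hs
  have hs0 : 0 ≤ s := Real.sqrt_nonneg _
  have hs2 : s ^ 2 = F - Y ^ 2 - β ^ 2 := Real.sq_sqrt hσ0
  have hβs : β ≤ s := le_of_sq_le_sq (by rw [hs2]; linarith only [hF1]) hs0
  have hsY : s ≤ Y := le_of_sq_le_sq (by rw [hs2]; linarith only [hF2]) hY.le
  -- the pieces of `N₀`
  have hA1 := quot_lower (S := SA) hα ha₁₂ hβs (by rw [hs2]; linarith only [hSA])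
  have hC1 := quot_lower (S := SC) hγ hc₁₂ hβs (by rw [hs2]; linarith only [hSC])
  have hdet := det_term_le hY hd (by rw [hs2]; ring)
  have hβτ := tau_term_le hY hβ hs0 hsY
  -- abbreviations
  set p := a₁ - β with hp
  set q := a₂ - s with hq
  set r := s - β with hr
  set τ := Y - s with hτ
  set p' := c₁ - β with hp'
  set q' := c₂ - s with hq'
  set E := ℓ - μ with hE
  have hr0 : 0 ≤ r := by rw [hr]; linarith only [hβs]
  have hτ0 : 0 ≤ τ := by rw [hτ]; linarith only [hsY]
  -- the master lower bound `N₀ ≤ E`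
  have hN : β * τ / Y + (p ^ 2 + q ^ 2) / (a₁ + a₂) / 2 + (p' ^ 2 + q' ^ 2) / (c₁ + c₂) / 2 + r ≤ E := by
    rw [hE, hℓ, hμ]; linarith only [hA1, hC1, hdet, hβτ, huA, hvC]
  have hN1 : 0 ≤ β * τ / Y := by positivity
  have hN2 : 0 ≤ (p ^ 2 + q ^ 2) / (a₁ + a₂) / 2 := by positivity
  have hN3 : 0 ≤ (p' ^ 2 + q' ^ 2) / (c₁ + c₂) / 2 := by positivity
  have hE0 : 0 ≤ E := by linarith only [hN, hN1, hN2, hN3, hr0]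
  refine ⟨by linarith only [hE0, hE], ?_⟩
  -- consequences of `N₀ ≤ E`
  have hpq : p ^ 2 + q ^ 2 ≤ 2 * (a₁ + a₂) * E := by
    have h1 : (p ^ 2 + q ^ 2) / (a₁ + a₂) / 2 ≤ E := by linarith only [hN, hN1, hN3, hr0]
    rw [div_div, div_le_iff₀ (by positivity)] at h1; linarith only [h1]
  have hpq' : p' ^ 2 + q' ^ 2 ≤ 2 * (c₁ + c₂) * E := by
    have h1 : (p' ^ 2 + q' ^ 2) / (c₁ + c₂) / 2 ≤ E := by linarith only [hN, hN1, hN2, hr0]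
    rw [div_div, div_le_iff₀ (by positivity)] at h1; linarith only [h1]
  have hrE : r ≤ E := by linarith only [hN, hN1, hN2, hN3]
  have hr2 : r ^ 2 ≤ Y * E := by
    have : r ≤ Y := by rw [hr]; linarith only [hsY, hβ]
    nlinarith only [this, hrE, hr0]
  have hβτE : β * τ ≤ Y * E := by
    have h1 : β * τ / Y ≤ E := by linarith only [hN, hN2, hN3, hr0]
    rw [div_le_iff₀ hY] at h1; linarith only [h1]
  -- `2Y - x ≤ 2τ + r + |p| + |q| + |p'| + |q'|`
  have hdevA : 2 * Y - (a₁ + a₂) = 2 * τ + r - p - q := by rw [hτ, hr, hp, hq]; ring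
  have hdevC : 2 * Y - (c₁ + c₂) = 2 * τ + r - p' - q' := by rw [hτ, hr, hp', hq']; ring
  have hxmin : a₁ + a₂ ≤ x ∨ c₁ + c₂ ≤ x := by
    rcases le_total (a₁ + a₂) (c₁ + c₂) with h | h
    · left
      have : (a₁ + a₂) ^ 2 ≤ x ^ 2 := by rw [hx2]; nlinarith only [h, hα]
      exact le_of_sq_le_sq this hx.le
    · right
      have : (c₁ + c₂) ^ 2 ≤ x ^ 2 := by rw [hx2]; nlinarith only [h, hγ]
      exact le_of_sq_le_sq this hx.le
  have hdev : 2 * Y - x ≤ 2 * τ + r + |p| + |q| + |p'| + |q'| := by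
    have h1 := abs_nonneg p; have h2 := abs_nonneg q; have h3 := abs_nonneg p'
    have h4 := abs_nonneg q'
    have h5 := neg_abs_le p; have h6 := neg_abs_le q; have h7 := neg_abs_le p'
    have h8 := neg_abs_le q'
    rcases hxmin with h | h
    · linarith only [h, hdevA, h1, h2, h3, h4, h5, h6, h7, h8]
    · linarith only [h, hdevC, h1, h2, h3, h4, h5, h6, h7, h8]
  have hpos : 0 ≤ 2 * Y - x := by linarith only [hlam]
  -- Cauchy–Schwarz with six terms
  have hsq : (2 * Y - x) ^ 2 ≤ 6 * (4 * τ ^ 2 + r ^ 2 + p ^ 2 + q ^ 2 + p' ^ 2 + q' ^ 2) := by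
    have h1 : (2 * Y - x) ^ 2 ≤ (2 * τ + r + |p| + |q| + |p'| + |q'|) ^ 2 :=
      pow_le_pow_left₀ hpos hdev 2
    have h2 := sq_sum6_le (2 * τ) r |p| |q| |p'| |q'|
    rw [sq_abs, sq_abs, sq_abs, sq_abs] at h2
    nlinarith only [h1, h2]
  -- the two cases of Lemma 2.2
  by_cases hcase : Y ≤ 4 * max Ξ 1 * β
  · -- all singular values comparable: `τ² ≤ 4Ξ₁ Y E`
    have hτE : τ ^ 2 ≤ 4 * max Ξ 1 * (Y * E) := by
      have h1 : τ ≤ Y := by rw [hτ]; linarith only [hs0]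
      have h2 : Y * τ ≤ 4 * max Ξ 1 * (β * τ) := by
        nlinarith only [mul_le_mul_of_nonneg_right hcase hτ0]
      nlinarith only [h1, h2, hβτE, hτ0, hΞ₁]
    have h2 : 4 * τ ^ 2 + r ^ 2 + p ^ 2 + q ^ 2 + p' ^ 2 + q' ^ 2 ≤
        (16 * max Ξ 1 * Y + Y + 2 * (a₁ + a₂) + 2 * (c₁ + c₂)) * E := by
      nlinarith only [hτE, hr2, hpq, hpq']
    have hΞx : max Ξ 1 * x ≤ max Ξ 1 ^ 2 * x := by
      nlinarith only [mul_nonneg (mul_nonneg (zero_le_one.trans hΞ₁) (sub_nonneg.2 hΞ₁)) hx.le]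
    have h3 : 16 * max Ξ 1 * Y + Y + 2 * (a₁ + a₂) + 2 * (c₁ + c₂) ≤ 25 * max Ξ 1 ^ 2 * x := by
      linarith only [mul_le_mul_of_nonneg_left hYx (by positivity : (0 : ℝ) ≤ 16 * max Ξ 1), hYx,
        hαx, hγx, hΞx]
    nlinarith only [hsq, h2, mul_le_mul_of_nonneg_right h3 hE0, hE0, hx, hΞ₁]
  · -- `b₁` small: `E` is a fraction of `x` outright
    push Not at hcase
    have hYα' : Y ≤ max Ξ 1 * (a₁ + a₂) := hYα.trans (by nlinarith only [hΞle, hα])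
    have hYγ' : Y ≤ max Ξ 1 * (c₁ + c₂) := hYγ.trans (by nlinarith only [hΞle, hγ])
    have hrqA : (a₁ + a₂) / 4 < r + q := by
      have e : a₂ = β + r + q := by rw [hr, hq]; ring
      nlinarith only [e, hcase, hYα', ha₁₂, hΞ₁]
    have hrqC : (c₁ + c₂) / 4 < r + q' := by
      have e : c₂ = β + r + q' := by rw [hr, hq']; ring
      nlinarith only [e, hcase, hYγ', hc₁₂, hΞ₁]
    have hEA : (a₁ + a₂) / 128 ≤ E := by
      rcases le_or_gt ((a₁ + a₂) / 8) r with h | h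
      · linarith only [h, hrE, hα]
      · have hq8 : (a₁ + a₂) / 8 < q := by linarith only [h, hrqA]
        have : ((a₁ + a₂) / 8) ^ 2 ≤ q ^ 2 := pow_le_pow_left₀ (by positivity) hq8.le 2
        nlinarith only [this, hpq, sq_nonneg p, hα, hE0]
    have hEC : (c₁ + c₂) / 128 ≤ E := by
      rcases le_or_gt ((c₁ + c₂) / 8) r with h | h
      · linarith only [h, hrE, hγ]
      · have hq8 : (c₁ + c₂) / 8 < q' := by linarith only [h, hrqC]
        have : ((c₁ + c₂) / 8) ^ 2 ≤ q' ^ 2 := pow_le_pow_left₀ (by positivity) hq8.le 2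
        nlinarith only [this, hpq', sq_nonneg p', hγ, hE0]
    have hsum : 2 * x ≤ (a₁ + a₂) + (c₁ + c₂) := by
      nlinarith only [sq_nonneg (a₁ + a₂ - (c₁ + c₂)), hx2, hx, hα, hγ]
    have hEx : x ≤ 128 * E := by linarith only [hEA, hEC, hsum]
    have h4 : (2 * Y - x) ^ 2 ≤ 4 * max Ξ 1 ^ 2 * x ^ 2 := by
      nlinarith only [mul_le_mul hYx hYx hY.le (by positivity), hpos, hx, hY, hlam]
    nlinarith only [h4, mul_le_mul_of_nonneg_left hEx (by positivity : (0 : ℝ) ≤ 4 * max Ξ 1 ^ 2 * x)]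

include ha₁₂ ha₂₃ hc₁₂ hc₂₃ hα hγ hx2 hx hY hF1 hF2 hSA' hSC' hΞ ha₃α ha₃γ hc₃α hc₃γ hYα hYγ hℓ in
/-- **`ℓ ≤ 14 Ξ₁³ x`** (Hamilton: "`D ≤ C|Rm|`", all spectral quantities are `O(a₁ + a₂)` by
Cor. 1.5, and `a₁ + a₂, c₁ + c₂ ≤ 2Ξ₁ x`). [cite: Hamilton1997, §2.2, Thm. 2.1 (proof, p. 16)] -/
theorem ell_le : ℓ ≤ 14 * max Ξ 1 ^ 3 * x := by
  have hΞ₁ : 1 ≤ max Ξ 1 := le_max_right _ _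
  have hΞle : Ξ ≤ max Ξ 1 := le_max_left _ _
  obtain ⟨hαx, hγx⟩ := sizes_le ha₁₂ ha₂₃ hc₁₂ hc₂₃ hα hγ hx2 hx hΞ ha₃γ hc₃α
  -- bounds in units of `α = a₁ + a₂` and `γ = c₁ + c₂`
  have ha₃' : a₃ ≤ max Ξ 1 * (a₁ + a₂) := ha₃α.trans (by nlinarith only [hΞle, hα])
  have hc₃' : c₃ ≤ max Ξ 1 * (c₁ + c₂) := hc₃γ.trans (by nlinarith only [hΞle, hγ])
  have hY' : Y ≤ max Ξ 1 * (a₁ + a₂) := hYα.trans (by nlinarith only [hΞle, hα])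
  have hY'' : Y ≤ max Ξ 1 * (c₁ + c₂) := hYγ.trans (by nlinarith only [hΞle, hγ])
  have hSA3 : SA ≤ 3 * Y ^ 2 := by linarith only [hSA', hF2, hF1]
  have hSC3 : SC ≤ 3 * Y ^ 2 := by linarith only [hSC', hF2, hF1]
  have hA : a₁ ^ 2 + a₂ ^ 2 + SA ≤ 5 * max Ξ 1 ^ 2 * (a₁ + a₂) ^ 2 := by
    have h1 : a₁ ^ 2 ≤ (max Ξ 1 * (a₁ + a₂)) ^ 2 := by
      refine sq_le_sq' ?_ ?_
      · nlinarith only [ha₁₂, ha₂₃, ha₃', hα, hΞ₁]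
      · nlinarith only [ha₁₂, hα, hΞ₁]
    have h2 : a₂ ^ 2 ≤ (max Ξ 1 * (a₁ + a₂)) ^ 2 :=
      pow_le_pow_left₀ (by linarith only [ha₁₂, hα]) (ha₂₃.trans ha₃') 2
    have h3 : Y ^ 2 ≤ (max Ξ 1 * (a₁ + a₂)) ^ 2 := pow_le_pow_left₀ hY.le hY' 2
    nlinarith only [h1, h2, h3, hSA3]
  have hC : c₁ ^ 2 + c₂ ^ 2 + SC ≤ 5 * max Ξ 1 ^ 2 * (c₁ + c₂) ^ 2 := by
    have h1 : c₁ ^ 2 ≤ (max Ξ 1 * (c₁ + c₂)) ^ 2 := by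
      refine sq_le_sq' ?_ ?_
      · nlinarith only [hc₁₂, hc₂₃, hc₃', hγ, hΞ₁]
      · nlinarith only [hc₁₂, hγ, hΞ₁]
    have h2 : c₂ ^ 2 ≤ (max Ξ 1 * (c₁ + c₂)) ^ 2 :=
      pow_le_pow_left₀ (by linarith only [hc₁₂, hγ]) (hc₂₃.trans hc₃') 2
    have h3 : Y ^ 2 ≤ (max Ξ 1 * (c₁ + c₂)) ^ 2 := pow_le_pow_left₀ hY.le hY'' 2
    nlinarith only [h1, h2, h3, hSC3]
  have hA' : (a₁ ^ 2 + a₂ ^ 2 + SA) / (a₁ + a₂) ≤ 5 * max Ξ 1 ^ 2 * (a₁ + a₂) := by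
    rw [div_le_iff₀ hα]; nlinarith only [hA]
  have hC' : (c₁ ^ 2 + c₂ ^ 2 + SC) / (c₁ + c₂) ≤ 5 * max Ξ 1 ^ 2 * (c₁ + c₂) := by
    rw [div_le_iff₀ hγ]; nlinarith only [hC]
  have h5 : 5 * max Ξ 1 ^ 2 * (a₁ + a₂) ≤ 10 * max Ξ 1 ^ 3 * x := by
    nlinarith only [mul_le_mul_of_nonneg_left hαx (by positivity : (0 : ℝ) ≤ 5 * max Ξ 1 ^ 2)]
  have h6 : 5 * max Ξ 1 ^ 2 * (c₁ + c₂) ≤ 10 * max Ξ 1 ^ 3 * x := by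
    nlinarith only [mul_le_mul_of_nonneg_left hγx (by positivity : (0 : ℝ) ≤ 5 * max Ξ 1 ^ 2)]
  have h7 : a₃ + c₃ ≤ 4 * max Ξ 1 ^ 3 * x := by
    have h8 : a₃ + c₃ ≤ max Ξ 1 * (a₁ + a₂) + max Ξ 1 * (c₁ + c₂) := by linarith only [ha₃', hc₃']
    have h9 : max Ξ 1 * (a₁ + a₂) + max Ξ 1 * (c₁ + c₂) ≤ 4 * max Ξ 1 ^ 2 * x := by
      nlinarith only [mul_le_mul_of_nonneg_left hαx (by positivity : (0 : ℝ) ≤ max Ξ 1),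
        mul_le_mul_of_nonneg_left hγx (by positivity : (0 : ℝ) ≤ max Ξ 1)]
    have h10 : 4 * max Ξ 1 ^ 2 * x ≤ 4 * max Ξ 1 ^ 3 * x := by
      nlinarith only [mul_nonneg (mul_nonneg (sq_nonneg (max Ξ 1)) (sub_nonneg.2 hΞ₁)) hx.le]
    linarith only [h8, h9, h10]
  rw [hℓ]; linarith only [hA', hC', h5, h6, h7]

end Lemma22

/-- **The bookkeeping of Hamilton's boundary computation (p. 15), barrier form.** Suppose
`μ ≤ ℓ`, `(2Y - x)² ≤ C_δ x(ℓ - μ)`, `ℓ ≤ C_ℓ x` with `C_δ, C_ℓ ≥ 0`, `x > 0`, `L ≥ 2`,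
`K ≥ C_ℓ C_δ`, and `G = (1 + K/L) x - 2Y ≤ 0` (so `K/L ≤ λ - 1`, `λ = 2Y/x`). Then
`(K/L²) ℓ ≤ (1 + K/L)(ℓ - μ)` and consequently, if moreover `μ ≤ M`,
`M · G ≤ (1 + K/L - K/L²) x ℓ - 2Y μ`. [cite: Hamilton1997, §2.2, Thm. 2.1 (proof, pp. 15–16)] -/
theorem improving_bookkeeping {ℓ μ Y x Cδ Cℓ K L G M : ℝ} (hμℓ : μ ≤ ℓ)
    (hδ : (2 * Y - x) ^ 2 ≤ Cδ * x * (ℓ - μ)) (hℓx : ℓ ≤ Cℓ * x) (hCδ : 0 ≤ Cδ) (hCℓ : 0 ≤ Cℓ)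
    (hx : 0 < x) (hL : 2 ≤ L) (hK : Cℓ * Cδ ≤ K) (hG : G = (1 + K / L) * x - 2 * Y) (hG0 : G ≤ 0)
    (hμM : μ ≤ M) : M * G ≤ (1 + K / L - K / L ^ 2) * x * ℓ - 2 * Y * μ := by
  have hL0 : 0 < L := by linarith
  have hK0 : 0 ≤ K := (mul_nonneg hCℓ hCδ).trans hK
  set κ := K / L with hκ
  have hκ0 : 0 ≤ κ := div_nonneg hK0 hL0.le
  -- `κ x ≤ 2Y - x`
  have hκx : κ * x ≤ 2 * Y - x := by rw [hG] at hG0; nlinarith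
  -- `κ² x ≤ C_δ (ℓ - μ)`
  have h1 : κ ^ 2 * x ≤ Cδ * (ℓ - μ) := by
    have h2 : (κ * x) ^ 2 ≤ (2 * Y - x) ^ 2 := pow_le_pow_left₀ (by positivity) hκx 2
    have h3 : κ ^ 2 * x * x ≤ Cδ * (ℓ - μ) * x := by nlinarith
    exact le_of_mul_le_mul_right h3 hx
  -- `(K/L²) ℓ = (κ²/K) ℓ ≤ ℓ - μ`
  have hkey : K / L ^ 2 * ℓ ≤ ℓ - μ := by
    rcases eq_or_lt_of_le hK0 with hK00 | hKpos
    · rw [← hK00]; simp; linarith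
    · have e : K / L ^ 2 = κ ^ 2 / K := by rw [hκ]; field_simp
      rw [e]
      have hℓ0 : K / L ^ 2 * ℓ ≤ K / L ^ 2 * (Cℓ * x) :=
        mul_le_mul_of_nonneg_left hℓx (by positivity)
      have h4 : κ ^ 2 / K * ℓ ≤ κ ^ 2 / K * (Cℓ * x) := mul_le_mul_of_nonneg_left hℓx (by positivity)
      have h5 : κ ^ 2 / K * (Cℓ * x) = Cℓ / K * (κ ^ 2 * x) := by ring
      have h6 : Cℓ / K * (κ ^ 2 * x) ≤ Cℓ / K * (Cδ * (ℓ - μ)) :=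
        mul_le_mul_of_nonneg_left h1 (by positivity)
      have h7 : Cℓ / K * (Cδ * (ℓ - μ)) = (Cℓ * Cδ / K) * (ℓ - μ) := by ring
      have h8 : Cℓ * Cδ / K ≤ 1 := by rw [div_le_one hKpos]; exact hK
      have h9 : (Cℓ * Cδ / K) * (ℓ - μ) ≤ 1 * (ℓ - μ) :=
        mul_le_mul_of_nonneg_right h8 (by linarith)
      linarith
  -- assemble: `(1 + κ - K/L²) x ℓ - 2Y μ = x[(1+κ)(ℓ - μ) - (K/L²) ℓ] + μ G ≥ μ G ≥ M G`
  have e : (1 + K / L - K / L ^ 2) * x * ℓ - 2 * Y * μ =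
      x * ((1 + κ) * (ℓ - μ) - K / L ^ 2 * ℓ) + μ * G := by rw [hG, hκ]; ring
  rw [e]
  have h10 : 0 ≤ (1 + κ) * (ℓ - μ) - K / L ^ 2 * ℓ := by nlinarith
  nlinarith [mul_nonneg hx.le h10, mul_le_mul_of_nonpos_right hμM hG0]

end HamiltonODE

end Literature.Geometry.Riemannian

end
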